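import Summits.BirchSwinnertonDyer.BirchSwinnertonDyer.Theorems.ThetaPartnerAtTwoSignedControlAtTwoPlusTowerIntegersTwo
import Summits.BirchSwinnertonDyer.BirchSwinnertonDyer.Theorems.ThetaPartnerAtTwoSignedControlAtTwoLadderGeneration
import HarnessLib

/-!
# The PLUS tower at `2`, III: the TOWER LEMMA `(T)` — `𝒪_{ℚ₂(v_M)} = ∑ᵢ ℤ·cᵢ + 2^k·𝒪_{ℚ₂(v_M)}` for the twisted
# `σ₃`-orbit `c₀ = 1`, `c_{i+1} = σ₃(cᵢ)·(1 + v_M)` (K4 `SignedControlAtTwo`, stmt-BirchSwinnertonDyer-20309, line `eulerchar` v6,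
# stub HONDA⁺@2 — memo `Cruxes/SignedControlAtTwo/LAGPLUS-AT-2-CONSTRUCTION.md` §4 (v))

Route `ThetaPartnerAtTwo` (TP2; crux shared with `ResidualThetaTransportAtTwo`), crux K4, lead seat `prover-bsd-wall-tp2-p3` (g2).
Sequel of `…PlusTowerTwo` / `…PlusTowerIntegersTwo` (namespace `SignedEC.PlusTower`) and the CONSUMER of the abstract ladder lemma
`SignedEC.Ladder.exists_mem_closure_add_pow_nsmul` (`…LadderGeneration`, p585594).

WHAT. Fix `M ≥ 2`, `v = v_M = ζ_{2^M} + ζ_{2^M}⁻¹ − 2` (a uniformizer of `k = ℚ₂(v) = ℚ₂(ζ_{2^M})⁺`, `[k : ℚ₂] = e = 2^{M−2}`,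
`𝒪_k = ⊕_{j<e} ℤ₂ v^j`, file II) and `σ = σ₃` (`σ ζ_{2^M} = ζ_{2^M}³`). The twisted operator `φ(y) = σ(y)·(1 + v)` preserves `𝒪_k`, and
* §1 `exists_ladder_polys`: in `ℤ[X]`, `P_σ^k·(1 + X) − X^k − X^{k+1} = X^{k+2}·F + 2·G` where `P_σ = X(1 + X² + 4X) + 2(X² + 4X)` is the
  polynomial with `σ(v) = P_σ(v)` (`σ₃(v_M) = (1 + v_{M−1})v_M + 2v_{M−1}`, `v_{M−1} = v_M² + 4v_M`, file I): the LADDER congruence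
  `φ(v^k) ≡ v^k + v^{k+1} (mod v^{k+2}ℤ[v] + 2𝒪_k)`;
* §2 `norm_algEquiv`, `sigma_v_eq_aeval`, `sigma_mem_adjoin_v`: `σ` is an isometry, the formula for `σ(v)`, `σ(k) ⊆ k`;
* §3 **`exists_mem_closure_iterate_add_two_pow_mul`** (the tower lemma `(T)`): every `x ∈ 𝒪_k` is, for every `k`,
  `x = s + 2^k·x'` with `s ∈ ⟨cᵢ : i ∈ ℕ⟩_ℤ`, `cᵢ = φ^i(1) = ∏_{j<i} σ^j(1 + v)`, and `x' ∈ 𝒪_k` — i.e. `𝒪_k = ℤ₂⟨cᵢ⟩` `2`-adically.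
  Proof = the abstract ladder lemma with rungs `b j = v^j`, top `e` (`v^j ∈ 2𝒪_k` for `j ≥ e` since `‖v‖^e = ‖2‖`), the ladder
  congruence of §1, and the span `𝒪_k = ∑_{j<e} ℤ v^j + 2𝒪_k` (file II + `ℤ₂ = ℤ + 2ℤ₂`).
WHY (memo §4 (v)–(vi)). With `c_i v_{M+1} ≡ σ^i(v_{M+1}) (mod 𝒪_k)` this gives `𝔪_{ℚ₂(v_{M+1})} = ℤ₂[σ]·v_{M+1} + 𝔪_k`, the additive
skeleton of the generation statement (GEN) of HONDA⁺@2 / «Prop 8.11⁺ at 2» (Kobayashi's Prop. 8.11 ⇒ 8.12 step along the PLUS tower at `p = 2`,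
where the cyclotomic-unit trick of the odd-`p` proof is replaced by this ladder); certified numerically for `M ≤ 11` by kit job j293539.

HONEST FRAMING: THEOREMS ONLY (no definition, no named fact, no `sorry`), route-independent; elementary local algebra in `ℚ̄₂`; closes no
item; BSD is not proved by any of this.

References: [Kobayashi2003] S. Kobayashi, Invent. Math. 152 (2003), Props. 8.11–8.12 (pp. 17–18: the shape of the generation argument);
[SerreLocalFields1979] Ch. IV §4; [Washington1997] Prop. 2.16, §13.1; [AtiyahMacdonald1969] Prop. 2.6, Cor. 2.7 (Nakayama).
-/

set_option autoImplicit false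
-- the Theorems namespace of this sub repeats the summit name by design (D-0017 nested layout)
set_option linter.dupNamespace false

noncomputable section

open scoped Classical IntermediateField
open Polynomial

namespace Summit.BirchSwinnertonDyer.BirchSwinnertonDyer.Theorems.SignedEC.PlusTower

open Summit.BirchSwinnertonDyer.Rank1Residual.Additive.PadicCyclotomicTower

/-! ## §1 The ladder congruence as a polynomial identity over `ℤ` -/

/-- **Ladder polynomials.** For every `k` there are `F, G ∈ ℤ[X]` with
`P_σ^k (1 + X) − X^k − X^{k+1} = X^{k+2} F + 2 G`, `P_σ = X(1 + X² + 4X) + 2(X² + 4X)`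
(`P_σ ≡ X(1 + X²) (mod 2)` and `(X(1+X²))^k(1+X) − X^k(1+X) = X^k(1+X)((1+X²)^k − 1) ∈ X^{k+2}ℤ[X]`). [folklore] -/
theorem exists_ladder_polys (k : ℕ) : ∃ F G : ℤ[X],
    (X * (1 + X ^ 2 + 4 * X) + 2 * (X ^ 2 + 4 * X)) ^ k * (1 + X) - X ^ k - X ^ (k + 1)
      = X ^ (k + 2) * F + 2 * G := by
  obtain ⟨H, hH⟩ :=
    sub_dvd_pow_sub_pow (X * (1 + X ^ 2 + 4 * X) + 2 * (X ^ 2 + 4 * X) : ℤ[X]) (X * (1 + X ^ 2)) k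
  obtain ⟨Q, hQ⟩ := sub_dvd_pow_sub_pow (1 + X ^ 2 : ℤ[X]) 1 k
  refine ⟨(1 + X) * Q, (3 * X ^ 2 + 4 * X) * H * (1 + X), ?_⟩
  have hH' : (X * (1 + X ^ 2 + 4 * X) + 2 * (X ^ 2 + 4 * X) : ℤ[X]) ^ k =
      (X * (1 + X ^ 2)) ^ k + 2 * ((3 * X ^ 2 + 4 * X) * H) := by
    have : (X * (1 + X ^ 2 + 4 * X) + 2 * (X ^ 2 + 4 * X) : ℤ[X]) - X * (1 + X ^ 2) =
        2 * (3 * X ^ 2 + 4 * X) := by ring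
    rw [this] at hH
    linear_combination hH
  have hQ' : ((1 + X ^ 2 : ℤ[X])) ^ k = 1 + X ^ 2 * Q := by
    rw [one_pow, show (1 + X ^ 2 : ℤ[X]) - 1 = X ^ 2 by ring] at hQ
    linear_combination hQ
  rw [hH', mul_pow, hQ']
  ring

/-! ## §2 `σ₃` on `k = ℚ₂(v_M)`: isometry, the formula for `σ(v)`, stability -/

/-- `Gal(ℚ̄₂/ℚ₂)` acts on `ℚ̄₂` by isometries (the norm is the spectral norm). (Same one-line proof as the private
`PadicAlgCl.norm_algEquiv` of `Literature…PadicEmbeddingRootsOfUnity`.) [cite: NeukirchANT1999, Ch. II (7.12)–(7.13)] -/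
theorem norm_algEquiv (σ : PadicAlgCl 2 ≃ₐ[ℚ_[2]] PadicAlgCl 2) (x : PadicAlgCl 2) : ‖σ x‖ = ‖x‖ := by
  rw [← PadicAlgCl.spectralNorm_eq, ← PadicAlgCl.spectralNorm_eq, ← spectralNorm_eq_of_equiv]

/-- **`σ₃(v_M) = P_σ(v_M)`** with `P_σ = X(1 + X² + 4X) + 2(X² + 4X)` (`M ≥ 1`; from `σ₃(v_M) = (1 + v_{M−1})v_M + 2v_{M−1}` and
`v_{M−1} = v_M² + 4v_M`). [cite: Washington1997, §13.1] -/
theorem sigma_v_eq_aeval {M : ℕ} (hM : 1 ≤ M) {σ : PadicAlgCl 2 ≃ₐ[ℚ_[2]] PadicAlgCl 2} (hσ : σ (zeta 2 M) = zeta 2 M ^ 3) :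
    σ (zeta 2 M + (zeta 2 M)⁻¹ - 2) =
      aeval (zeta 2 M + (zeta 2 M)⁻¹ - 2) (X * (1 + X ^ 2 + 4 * X) + 2 * (X ^ 2 + 4 * X) : ℤ[X]) := by
  obtain ⟨m, rfl⟩ := Nat.exists_eq_add_of_le' hM
  rw [sigma_three_v_succ hσ, ← v_succ_sq_add m]
  simp only [map_add, map_mul, aeval_X, map_pow, map_one, map_ofNat]
  ring

/-- `‖v_M‖ ≤ 1` (`M ≥ 2`; indeed `‖v_M‖^{2^{M−2}} = ‖2‖ < 1`). [folklore] -/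
theorem norm_v_le_one {M : ℕ} (hM : 2 ≤ M) : ‖zeta 2 M + (zeta 2 M)⁻¹ - 2‖ ≤ 1 := by
  by_contra h
  push Not at h
  have h1 : (1 : ℝ) < ‖zeta 2 M + (zeta 2 M)⁻¹ - 2‖ ^ 2 ^ (M - 2) :=
    one_lt_pow₀ h (pow_ne_zero _ two_ne_zero)
  rw [norm_v_pow_eq hM] at h1
  have h2 := (Literature.NumberTheory.GaloisRepresentations.PadicAlgCl.norm_natCast_prime_pos_lt_one (p := 2)).2
  have h3 : ‖((2 : ℕ) : PadicAlgCl 2)‖ = ‖(2 : PadicAlgCl 2)‖ := by norm_cast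
  rw [h3] at h2
  exact absurd (h1.trans h2) (lt_irrefl _)

/-- **`σ₃` preserves `k = ℚ₂(v_M)`** (`M ≥ 2`): `σ(v) = P_σ(v) ∈ k`, and `k` is spanned by powers of `v`. [folklore] -/
theorem sigma_mem_adjoin_v {M : ℕ} (hM : 2 ≤ M) {σ : PadicAlgCl 2 ≃ₐ[ℚ_[2]] PadicAlgCl 2} (hσ : σ (zeta 2 M) = zeta 2 M ^ 3)
    {y : PadicAlgCl 2} (hy : y ∈ ℚ_[2]⟮zeta 2 M + (zeta 2 M)⁻¹ - 2⟯) :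
    σ y ∈ ℚ_[2]⟮zeta 2 M + (zeta 2 M)⁻¹ - 2⟯ := by
  set v := zeta 2 M + (zeta 2 M)⁻¹ - 2 with hv
  set K := ℚ_[2]⟮v⟯ with hK
  have hvK : v ∈ K := IntermediateField.mem_adjoin_simple_self ℚ_[2] v
  have hσv : σ v ∈ K := by
    rw [hv, sigma_v_eq_aeval (by omega) hσ, ← hv, aeval_eq_sum_range]
    exact sum_mem fun i _ ↦ zsmul_mem (pow_mem hvK i) _
  obtain ⟨r, -, rfl⟩ := exists_aeval_v_eq hM hy
  rw [aeval_eq_sum_range, map_sum]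
  refine sum_mem fun i _ ↦ ?_
  rw [Algebra.smul_def, map_mul, map_pow, AlgEquiv.commutes]
  exact mul_mem (IntermediateField.algebraMap_mem K _) (pow_mem hσv i)

/-! ## §3 The tower lemma `(T)` -/

/-- **TOWER LEMMA `(T)` for `𝒪_{ℚ₂(ζ_{2^M})⁺}`** (`M ≥ 2`, `v = v_M`, `σ = σ₃`, `φ(y) = σ(y)(1 + v)`, `cᵢ = φ^i(1)`):
for every `k` and every `x ∈ ℚ₂(v)` with `‖x‖ ≤ 1` there are `s ∈ ⟨cᵢ : i ∈ ℕ⟩_ℤ` and `x' ∈ ℚ₂(v)`, `‖x'‖ ≤ 1`, with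
`x = s + 2^k x'`; i.e. `𝒪_{ℚ₂(v_M)} = ℤ₂⟨c₀, c₁, …⟩`. Instance of `SignedEC.Ladder.exists_mem_closure_add_pow_nsmul` (rungs `v^j`,
top `2^{M−2}`, ladder congruence `exists_ladder_polys`, span from `exists_intPoly_aeval_v_eq`). Memo LAGPLUS-AT-2-CONSTRUCTION §4 (v);
kit-certified for `M ≤ 11` (j293539). [cite: Kobayashi2003, Props. 8.11–8.12] [cite: AtiyahMacdonald1969, Cor. 2.7] -/
theorem exists_mem_closure_iterate_add_two_pow_mul {M : ℕ} (hM : 2 ≤ M) {σ : PadicAlgCl 2 ≃ₐ[ℚ_[2]] PadicAlgCl 2}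
    (hσ : σ (zeta 2 M) = zeta 2 M ^ 3) (k : ℕ) {x : PadicAlgCl 2}
    (hx : x ∈ ℚ_[2]⟮zeta 2 M + (zeta 2 M)⁻¹ - 2⟯) (hx1 : ‖x‖ ≤ 1) :
    ∃ s ∈ AddSubgroup.closure
        (Set.range fun i : ℕ ↦ (fun y : PadicAlgCl 2 ↦ σ y * (1 + (zeta 2 M + (zeta 2 M)⁻¹ - 2)))^[i] 1),
      ∃ x' ∈ ℚ_[2]⟮zeta 2 M + (zeta 2 M)⁻¹ - 2⟯, ‖x'‖ ≤ 1 ∧ x = s + 2 ^ k * x' := by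
  set v := zeta 2 M + (zeta 2 M)⁻¹ - 2 with hv
  set K := ℚ_[2]⟮v⟯ with hK
  set e : ℕ := 2 ^ (M - 2) with he
  have hvK : v ∈ K := IntermediateField.mem_adjoin_simple_self ℚ_[2] v
  have hv1 : ‖v‖ ≤ 1 := norm_v_le_one hM
  have h2 : ‖((2 : ℕ) : PadicAlgCl 2)‖ = ‖(2 : PadicAlgCl 2)‖ := by norm_cast
  have hve : ‖v‖ ^ e = ‖(2 : PadicAlgCl 2)‖ := norm_v_pow_eq hM
  have h2pos : 0 < ‖(2 : PadicAlgCl 2)‖ := by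
    rw [← h2]; exact (Literature.NumberTheory.GaloisRepresentations.PadicAlgCl.norm_natCast_prime_pos_lt_one (p := 2)).1
  have h20 : (2 : PadicAlgCl 2) ≠ 0 := norm_pos_iff.mp h2pos
  have h2K : (2 : PadicAlgCl 2) ∈ K := by
    rw [show (2 : PadicAlgCl 2) = algebraMap ℚ_[2] (PadicAlgCl 2) 2 from (map_ofNat _ 2).symm]
    exact IntermediateField.algebraMap_mem K 2
  -- the order `O = 𝒪_k = {y ∈ K, ‖y‖ ≤ 1}` as a subgroup / `ℤ`-submodule of `ℚ̄₂`
  let Og : AddSubgroup (PadicAlgCl 2) :=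
    { carrier := {y | y ∈ K ∧ ‖y‖ ≤ 1}
      add_mem' := fun {a b} ha hb ↦
        ⟨add_mem ha.1 hb.1, (IsUltrametricDist.norm_add_le_max a b).trans (max_le ha.2 hb.2)⟩
      zero_mem' := ⟨zero_mem K, by simp⟩
      neg_mem' := fun {a} ha ↦ ⟨neg_mem ha.1, by rw [norm_neg]; exact ha.2⟩ }
  let O : Submodule ℤ (PadicAlgCl 2) := Og.toIntSubmodule
  have hO : ∀ {y : PadicAlgCl 2}, y ∈ O ↔ y ∈ K ∧ ‖y‖ ≤ 1 := fun {y} ↦ Iff.rfl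
  -- the twisted operator `φ y = σ y · (1 + v)` on `ℚ̄₂`, restricted to `O`
  let φ₀ : PadicAlgCl 2 →ₗ[ℤ] PadicAlgCl 2 :=
    ((AddMonoidHom.mulRight (1 + v)).comp σ.toRingEquiv.toAddMonoidHom).toIntLinearMap
  have hφ₀ : ∀ y, φ₀ y = σ y * (1 + v) := fun y ↦ rfl
  have h1v : ‖1 + v‖ ≤ 1 := (IsUltrametricDist.norm_add_le_max 1 v).trans (max_le norm_one.le hv1)
  have hφO : ∀ y ∈ O, φ₀ y ∈ O := by
    intro y hy
    rw [hO] at hy ⊢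
    refine ⟨?_, ?_⟩
    · rw [hφ₀]; exact mul_mem (sigma_mem_adjoin_v hM hσ hy.1) (add_mem (one_mem K) hvK)
    · rw [hφ₀, norm_mul, norm_algEquiv]
      exact mul_le_one₀ hy.2 (norm_nonneg _) h1v
  let φ : Module.End ℤ O := φ₀.restrict hφO
  have hφ : ∀ y : O, ((φ y : O) : PadicAlgCl 2) = σ y * (1 + v) := fun y ↦ rfl
  -- the rungs `b j = v^j`
  have hvjO : ∀ j : ℕ, v ^ j ∈ O := fun j ↦
    hO.mpr ⟨pow_mem hvK j, (norm_pow v j).le.trans (pow_le_one₀ (norm_nonneg v) hv1)⟩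
  let b : ℕ → O := fun j ↦ ⟨v ^ j, hvjO j⟩
  have hb : ∀ j, ((b j : O) : PadicAlgCl 2) = v ^ j := fun j ↦ rfl
  -- (top) `v^j ∈ 2·O` for `j ≥ e`
  have htop : ∀ j, e ≤ j → ∃ a' : O, b j = 2 • a' := by
    intro j hj
    have hmem : v ^ j / 2 ∈ O := by
      refine hO.mpr ⟨div_mem (pow_mem hvK j) h2K, ?_⟩
      rw [norm_div, div_le_one h2pos, ← hve, norm_pow]
      exact pow_le_pow_of_le_one (norm_nonneg v) hv1 hj
    refine ⟨⟨v ^ j / 2, hmem⟩, Subtype.ext ?_⟩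
    change v ^ j = ((2 • (⟨v ^ j / 2, hmem⟩ : O) : O) : PadicAlgCl 2)
    rw [Submodule.coe_smul_of_tower, two_nsmul, add_halves]
  -- (ladder) `φ(v^k) − v^k − v^{k+1} ∈ ⟨v^j : j ≥ k+2⟩ + 2·O`
  have hlad : ∀ k, k < e → ∃ f ∈ AddSubgroup.closure (b '' Set.Ici (k + 2)), ∃ a' : O,
      φ (b k) - b k - b (k + 1) = f + 2 • a' := by
    intro k _
    obtain ⟨F, G, hFG⟩ := exists_ladder_polys k
    -- `f = ∑ F_i v^{k+2+i}`, `a' = G(v)`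
    have hGO : aeval v G ∈ O := by
      refine hO.mpr ⟨?_, ?_⟩
      · rw [aeval_eq_sum_range]
        exact sum_mem fun i _ ↦ zsmul_mem (pow_mem hvK i) _
      · rw [aeval_eq_sum_range]
        refine IsUltrametricDist.norm_sum_le_of_forall_le_of_nonneg zero_le_one fun i _ ↦ ?_
        exact (IsUltrametricDist.norm_zsmul_le _ _).trans
          ((norm_pow v i).le.trans (pow_le_one₀ (norm_nonneg v) hv1))
    refine ⟨∑ i ∈ Finset.range (F.natDegree + 1), F.coeff i • b (k + 2 + i), ?_, ⟨aeval v G, hGO⟩, ?_⟩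
    · refine AddSubgroup.sum_mem _ fun i _ ↦ AddSubgroup.zsmul_mem _ ?_ _
      exact AddSubgroup.subset_closure ⟨k + 2 + i, Set.mem_Ici.mpr (by omega), rfl⟩
    · apply Subtype.ext
      have hσv : σ v = aeval v (X * (1 + X ^ 2 + 4 * X) + 2 * (X ^ 2 + 4 * X) : ℤ[X]) :=
        sigma_v_eq_aeval (by omega) hσ
      have hid := congrArg (aeval v) hFG
      simp only [map_sub, map_mul, map_add, map_pow, aeval_X, map_one, map_ofNat] at hid
      have hF : v ^ (k + 2) * aeval v F = ∑ i ∈ Finset.range (F.natDegree + 1), F.coeff i • v ^ (k + 2 + i) := by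
        rw [aeval_eq_sum_range, Finset.mul_sum]
        refine Finset.sum_congr rfl fun i _ ↦ ?_
        rw [mul_smul_comm, ← pow_add]
      simp only [Submodule.coe_sub, Submodule.coe_add, Submodule.coe_sum, Submodule.coe_smul,
        Submodule.coe_smul_of_tower, hφ, hb]
      rw [map_pow, hσv, ← hF, nsmul_eq_mul, Nat.cast_ofNat]
      simp only [map_add, map_mul, aeval_X, map_pow, map_one, map_ofNat] at hid ⊢
      linear_combination hid
  -- (span) `O = ∑_{j<e} ℤ v^j + 2·O`
  have hspan : ∀ a : O, ∃ f ∈ AddSubgroup.closure (Set.range b), ∃ a' : O, a = f + 2 • a' := by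
    intro a
    obtain ⟨r, -, hrc, hra⟩ := exists_intPoly_aeval_v_eq hM (hO.mp a.2).1 (hO.mp a.2).2
    -- integer parts `n j` and remainders `c j ∈ ℤ₂` of the coefficients: `r_j = n_j + 2 c_j`
    have hsplit : ∀ j, ∃ n : ℕ, ∃ c : ℤ_[2], r.coeff j = (n : ℚ_[2]) + 2 * (c : ℚ_[2]) := by
      intro j
      set z : ℤ_[2] := ⟨r.coeff j, hrc j⟩ with hz
      obtain ⟨c, hc⟩ := Ideal.mem_span_singleton'.mp (PadicInt.appr_spec 1 z)
      refine ⟨z.appr 1, c, ?_⟩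
      have hz' : (z : ℚ_[2]) = r.coeff j := rfl
      have h2c : ((2 : ℤ_[2]) : ℚ_[2]) = 2 := PadicInt.coe_natCast 2
      have h := congrArg ((↑) : ℤ_[2] → ℚ_[2]) hc
      push_cast [h2c] at h
      rw [← hz']
      linear_combination -h
    choose n c hnc using hsplit
    set d := r.natDegree + 1 with hd
    have hcO : (∑ j ∈ Finset.range d, ((c j : ℚ_[2]) : PadicAlgCl 2) * v ^ j) ∈ O := by
      refine hO.mpr ⟨sum_mem fun j _ ↦ mul_mem ?_ (pow_mem hvK j), ?_⟩
      · exact IntermediateField.algebraMap_mem K _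
      · refine IsUltrametricDist.norm_sum_le_of_forall_le_of_nonneg zero_le_one fun j _ ↦ ?_
        rw [norm_mul, norm_pow, PadicAlgCl.norm_extends, PadicInt.padic_norm_e_of_padicInt]
        exact mul_le_one₀ (PadicInt.norm_le_one _) (pow_nonneg (norm_nonneg _) _) (pow_le_one₀ (norm_nonneg _) hv1)
    refine ⟨∑ j ∈ Finset.range d, (n j : ℤ) • b j, ?_, (⟨_, hcO⟩ : O), Subtype.ext ?_⟩
    · exact AddSubgroup.sum_mem _ fun j _ ↦
        AddSubgroup.zsmul_mem _ (AddSubgroup.subset_closure (Set.mem_range_self j)) _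
    · simp only [Submodule.coe_add, Submodule.coe_sum, Submodule.coe_smul, Submodule.coe_smul_of_tower, hb]
      rw [← hra, aeval_eq_sum_range, ← hd, nsmul_eq_mul, Nat.cast_ofNat, Finset.mul_sum, ← Finset.sum_add_distrib]
      refine Finset.sum_congr rfl fun j _ ↦ ?_
      rw [Algebra.smul_def, hnc j, map_add, map_mul, map_natCast, map_ofNat]
      change ((n j : PadicAlgCl 2) + 2 * ((c j : ℚ_[2]) : PadicAlgCl 2)) * v ^ j = _
      rw [zsmul_eq_mul, Int.cast_natCast]
      ring
  -- the abstract ladder lemma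
  obtain ⟨s, hs, a', ha'⟩ :=
    Ladder.exists_mem_closure_add_pow_nsmul φ 2 b e htop hlad hspan k ⟨x, hO.mpr ⟨hx, hx1⟩⟩
  refine ⟨s, ?_, a', (hO.mp a'.2).1, (hO.mp a'.2).2, ?_⟩
  · -- transport the closure along `O ⊆ ℚ̄₂`, identifying `φ^i (b 0)` with `φ₀^[i] 1`
    have hiter : ∀ i : ℕ, (((φ ^ i) (b 0) : O) : PadicAlgCl 2) =
        (fun y : PadicAlgCl 2 ↦ σ y * (1 + v))^[i] 1 := by
      intro i
      induction i with
      | zero => rw [pow_zero, Module.End.one_apply, Function.iterate_zero_apply, hb, pow_zero]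
      | succ i ih => rw [pow_succ', Module.End.mul_apply, hφ, ih, Function.iterate_succ_apply']
    have hmap := AddSubgroup.mem_map_of_mem O.toAddSubgroup.subtype hs
    rw [AddMonoidHom.map_closure, ← Set.range_comp] at hmap
    have hrange : (⇑O.toAddSubgroup.subtype ∘ fun i : ℕ ↦ (φ ^ i) (b 0)) =
        fun i : ℕ ↦ (fun y : PadicAlgCl 2 ↦ σ y * (1 + v))^[i] 1 := funext fun i ↦ hiter i
    rw [hrange] at hmap
    exact hmap
  · have := congrArg (Subtype.val : O → PadicAlgCl 2) ha'
    simpa [Submodule.coe_add, Submodule.coe_smul_of_tower, nsmul_eq_mul] using this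

end Summit.BirchSwinnertonDyer.BirchSwinnertonDyer.Theorems.SignedEC.PlusTower

end
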